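import Summits.AtomisticToContinuum.BoseEinsteinCondensation.Theorems.BECCutLineWeakDisorderGroundStateRigidityStubCutStateBound
import Summits.AtomisticToContinuum.BoseEinsteinCondensation.Theorems.BECCutLineWeakDisorderGroundStateRigidityStubLincombGroundState
import Literature.Analysis.FunctionSpaces.TestFunctionDensity
import HarnessLib

/-!
# Crux `GroundStateRigidity` (stmt-AtomisticToContinuum-9072), line `Sketch`:
# helpers for the registered stub `stub_closedEnergyTruncHardCore` (Stub 15g, the glue of Stub 15)

Supports (does not close) stmt-AtomisticToContinuum-9072; auxiliary file of stub
`stub_closedEnergyTruncHardCore` of line Sketch (lead c4, skeleton v8), imported by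
`BECCutLineWeakDisorderGroundStateRigidityStubClosedEnergyTruncHardCore.lean`. Contents (namespace
`GroundStateRigidity.ClosedEnergyTrunc`): measurability of pair events, an `ℝ≥0∞` limit, the
bound of a double shell sum by `N²` times a uniform bound, `|∇f|² ≤ 2|∇g|² + 2|∇(f-g)|²`, the
CORE MASS bound `m ∫_{some pair ≤ b} |Φ|² ≤ energy (v ⊓ m) Φ` for the hard-core class
(`core_le`), and the construction of ONE cut state (`one_step`): given the registered statements of
Stubs 15a/15b/15d as hypotheses and the diagonal trial states `Φₘ` with their kinetic Cauchy
property, for every `θ, τ > 0` a `C¹` Dirichlet symmetric `G` with `∫|G - Ψ|² ≤ 4τ` and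
`Q_v(G) ≤ (1+θ)(S+τ) + τ` (the landed Stub 15f `stub_cutStateBound` supplies the cut-state bounds).
The registered landing stub of this file is `stub_closedEnergyTruncOneStep` (= `one_step`,
binders explicit).
-/

noncomputable section

open MeasureTheory Filter Set Metric
open scoped ENNReal NNReal Topology

namespace Summit.AtomisticToContinuum.BoseEinsteinCondensation.Theorems.GroundStateRigidity

open Literature.MathematicalPhysics.QuantumManyBody.BoseGas
open Literature.Analysis.FunctionSpaces (tendsto_inv_natCast_add_one)

namespace ClosedEnergyTrunc

variable {N : ℕ} {L : ℝ}

/-! ### Small facts -/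

/-- Pair events `{∃ i ≠ j, |xᵢ - xⱼ| ∈ P}` are measurable for measurable `P ⊆ ℝ`. [folklore] -/
theorem measurableSet_pair (p : ℝ → Prop) (hp : MeasurableSet {r | p r}) :
    MeasurableSet {Y : Config N | ∃ i j : Fin N, i ≠ j ∧ p (dist (Y i) (Y j))} := by
  simp only [setOf_exists, setOf_and]
  exact MeasurableSet.iUnion fun i => MeasurableSet.iUnion fun j =>
    (MeasurableSet.const _).inter (hp.preimage (measurable_dist_pair i j))

/-- `c · (d / m) → 0` as `m → ∞`, for finite `c, d`. [folklore] -/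
theorem tendsto_const_mul_div_nat {c d : ℝ≥0∞} (hc : c ≠ ⊤) (hd : d ≠ ⊤) :
    Tendsto (fun m : ℕ => c * (d / m)) atTop (𝓝 0) := by
  have h := ENNReal.Tendsto.const_mul ENNReal.tendsto_inv_nat_nhds_zero
    (Or.inr (ENNReal.mul_ne_top hc hd)) (a := c * d)
  rw [mul_zero] at h
  refine h.congr fun m => ?_
  rw [div_eq_mul_inv, mul_assoc]

/-- A double shell sum is at most `N²` times a uniform bound on its terms. [folklore] -/
theorem sum_sum_le {f : Fin N → Fin N → ℝ≥0∞} {c : ℝ≥0∞} (h : ∀ i j, i ≠ j → f i j ≤ c) :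
    ∑ i : Fin N, ∑ j ∈ Finset.univ.erase i, f i j ≤ (N : ℝ≥0∞) * ((N : ℝ≥0∞) * c) := by
  calc ∑ i : Fin N, ∑ j ∈ Finset.univ.erase i, f i j
      ≤ ∑ i : Fin N, ∑ j ∈ Finset.univ.erase i, c := Finset.sum_le_sum fun i _ =>
        Finset.sum_le_sum fun j hj => h i j (Finset.ne_of_mem_erase hj).symm
    _ ≤ ∑ _i : Fin N, ∑ _j : Fin N, c :=
        Finset.sum_le_sum fun i _ => Finset.sum_le_sum_of_subset (Finset.erase_subset _ _)
    _ = _ := by simp only [Finset.sum_const, Finset.card_univ, Fintype.card_fin, nsmul_eq_mul]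

/-- `|∇f|² ≤ 2|∇g|² + 2|∇(f - g)|²` pointwise (parallelogram law for `g` and `f - g`). [folklore] -/
theorem kinetic_le_two_add {f g : Config N → ℂ} (hf : Differentiable ℝ f)
    (hg : Differentiable ℝ g) (X : Config N) :
    kineticDensity f X ≤ 2 * kineticDensity g X + 2 * kineticDensity (fun Y => f Y - g Y) X := by
  have h : kineticDensity (fun Y => g Y + (f Y - g Y)) X +
      kineticDensity (fun Y => g Y - (f Y - g Y)) X =
        2 * kineticDensity g X + 2 * kineticDensity (fun Y => f Y - g Y) X :=
    LincombGS.kinetic_add_sub hg (hf.sub hg) X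
  calc kineticDensity f X = kineticDensity (fun Y => g Y + (f Y - g Y)) X := by
        simp only [add_sub_cancel]
    _ ≤ _ := le_self_add
    _ = _ := h

/-- **Core mass.** Where some pair is at distance `≤ b` the truncated hard-core interaction is
`≥ m` (`v ⊓ m = m` on `[0, b]`), so `m ∫_{some pair ≤ b} |Φ|² ≤ energy (v ⊓ m) Φ`. [folklore] -/
theorem core_le {v : ℝ → ℝ≥0∞} {b : ℝ} (hcore : ∀ t : ℝ, t ∈ Set.Icc 0 b → v t = ⊤)
    (Φ : TrialState N L) (m : ℕ) :
    (m : ℝ≥0∞) * ∫⁻ X, {Y : Config N | ∃ i j : Fin N, i ≠ j ∧ dist (Y i) (Y j) ≤ b}.indicator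
        (fun Y => (‖Φ.ψ Y‖₊ : ℝ≥0∞) ^ 2) X ≤ energy (fun r => min (v r) (m : ℝ≥0∞)) Φ := by
  rw [← lintegral_const_mul' _ _ (ENNReal.natCast_ne_top m)]
  refine lintegral_mono fun X => ?_
  by_cases hX : X ∈ {Y : Config N | ∃ i j : Fin N, i ≠ j ∧ dist (Y i) (Y j) ≤ b}
  · rw [indicator_of_mem hX]
    obtain ⟨i, j, hij, hd⟩ := hX
    -- one pair term of the truncated interaction already equals `m`
    have key : ∀ {i j : Fin N}, i < j → dist (X i) (X j) ≤ b →
        (m : ℝ≥0∞) ≤ interaction (fun r => min (v r) (m : ℝ≥0∞)) X := by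
      intro i j hij hd
      unfold interaction
      calc (m : ℝ≥0∞) = min (v (dist (X i) (X j))) (m : ℝ≥0∞) := by
            rw [hcore _ ⟨dist_nonneg, hd⟩, min_eq_right le_top]
        _ ≤ ∑ j' ∈ Finset.univ.filter (fun j' => i < j'),
              min (v (dist (X i) (X j'))) (m : ℝ≥0∞) :=
            Finset.single_le_sum (f := fun j' => min (v (dist (X i) (X j'))) (m : ℝ≥0∞))
              (fun _ _ => zero_le) (Finset.mem_filter.2 ⟨Finset.mem_univ j, hij⟩)
        _ ≤ _ := Finset.single_le_sum (f := fun i' => ∑ j' ∈ Finset.univ.filter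
              (fun j' => i' < j'), min (v (dist (X i') (X j'))) (m : ℝ≥0∞))
            (fun _ _ => zero_le) (Finset.mem_univ i)
    have hm : (m : ℝ≥0∞) ≤ interaction (fun r => min (v r) (m : ℝ≥0∞)) X := by
      rcases hij.lt_or_gt with h | h
      · exact key h hd
      · exact key h (by rwa [dist_comm])
    calc (m : ℝ≥0∞) * _ ≤ interaction (fun r => min (v r) (m : ℝ≥0∞)) X * _ :=
          mul_le_mul' hm le_rfl
      _ ≤ _ := le_add_self
  · rw [indicator_of_notMem hX, mul_zero]
    exact zero_le

/-! ### One cut state -/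

/-- **One cut state.** Given the statements of Stubs 15a (for a fixed constant `A`), 15b, 15d at
`(N, b)`, the diagonal trial states `Φₘ` of 15e for `S < ⊤` and their kinetic Cauchy property
(15c): for every `θ > 0` and `τ > 0` there is a `C¹`, Dirichlet, symmetric `G` with
`∫|G - Ψ|² ≤ 4τ` and `Q_v(G) ≤ (1+θ)(S + τ) + τ`. `G = χ Φₘ` with `χ` the cutoff of 15a at radii
`b < b + 3s`: `s` from 15d applied to `Φ_M` (`M` the Cauchy index for a kinetic tolerance `ε`),
so the layer kinetic energy of every `Φₘ`, `m ≥ M`, is `≤ 4ε`; the shell masses are then small by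
15b (inner cutoff of 15a at radii `b - s < b`) and the core mass `≤ (S+1)/m` (`core_le`); 15f
gives the form and distance bounds, in which `A/(9s²) · 288 s² = 32A`.
[cite: LSSY2005, proof of Thm 2.4] -/
theorem one_step {A C : ℝ≥0} {b : ℝ} {v : ℝ → ℝ≥0∞} {Ψ : Config N → ℂ}
    (hCut : ∀ r₁ r₂ : ℝ, 0 < r₁ → r₁ < r₂ →
      ∃ χ : Config N → ℝ, ContDiff ℝ 1 χ ∧ (∀ X, 0 ≤ χ X ∧ χ X ≤ 1) ∧
        (∀ (σ : Equiv.Perm (Fin N)) (X : Config N), χ (X ∘ σ) = χ X) ∧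
        (∀ X : Config N, (∃ i j : Fin N, i ≠ j ∧ dist (X i) (X j) ≤ r₁) → χ X = 0) ∧
        (∀ X : Config N, (∀ i j : Fin N, i ≠ j → r₂ ≤ dist (X i) (X j)) → χ X = 1) ∧
        (∀ X : Config N, realKinetic χ X ≤
          {Y : Config N | ∃ i j : Fin N, i ≠ j ∧ r₁ < dist (Y i) (Y j) ∧
              dist (Y i) (Y j) < r₂}.indicator
            (fun _ => ENNReal.ofReal ((A : ℝ) / (r₂ - r₁) ^ 2)) X))
    (hShell : ∀ (s : ℝ) (η : Config N → ℝ) (ψ : Config N → ℂ) (i j : Fin N), i ≠ j →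
      0 < s → 81 * s ≤ b → ContDiff ℝ 1 η → (∀ X, 0 ≤ η X ∧ η X ≤ 1) →
      (∀ X : Config N, (∃ i' j' : Fin N, i' ≠ j' ∧ dist (X i') (X j') ≤ b - s) → η X = 0) →
      (∀ X : Config N, (∀ i' j' : Fin N, i' ≠ j' → b ≤ dist (X i') (X j')) → η X = 1) →
      (∀ X : Config N, realKinetic η X ≤
        {Y : Config N | ∃ i' j' : Fin N, i' ≠ j' ∧ b - s < dist (Y i') (Y j') ∧
            dist (Y i') (Y j') < b}.indicator (fun _ => ENNReal.ofReal ((A : ℝ) / s ^ 2)) X) →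
      ContDiff ℝ 1 ψ →
      ∫⁻ X, (shellPair b (3 * s) i j).indicator (fun Y => (‖ψ Y‖₊ : ℝ≥0∞) ^ 2) X ≤
        ENNReal.ofReal (288 * s ^ 2) *
            (∫⁻ X, (shellPair (b - s) (4 * s) i j).indicator (kineticDensity ψ) X) +
          (288 * (A : ℝ≥0∞) + 1) *
            ∫⁻ X, {Y : Config N | ∃ i' j' : Fin N, i' ≠ j' ∧ dist (Y i') (Y j') < b}.indicator
              (fun Y => (‖ψ Y‖₊ : ℝ≥0∞) ^ 2) X)
    (hLayer : ∀ Φ : Config N → ℂ, ContDiff ℝ 1 Φ → ∫⁻ X, kineticDensity Φ X ≠ ⊤ →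
      ∀ ε : ℝ≥0∞, 0 < ε → ∃ s : ℝ, 0 < s ∧
        ∫⁻ X, {Y : Config N | ∃ i j : Fin N, i ≠ j ∧ b - s < dist (Y i) (Y j) ∧
            dist (Y i) (Y j) < b + 3 * s}.indicator (kineticDensity Φ) X ≤ ε)
    (hb : 0 < b) (hv : Measurable v) (hcore : ∀ t : ℝ, t ∈ Set.Icc 0 b → v t = ⊤)
    (hC : ∀ t : ℝ, b < t → v t ≤ C) {S : ℝ≥0∞} (hS : S ≠ ⊤) {Φ : ℕ → TrialState N L}
    (hΦE : ∀ m : ℕ, energy (fun r => min (v r) (m : ℝ≥0∞)) (Φ m) ≤ S + ((m : ℝ≥0∞) + 1)⁻¹)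
    (hΦd : ∀ m : ℕ, ∫⁻ X, (‖(Φ m).ψ X - Ψ X‖₊ : ℝ≥0∞) ^ 2 ≤ ((m : ℝ≥0∞) + 1)⁻¹)
    (hCauchy : ∀ ε : ℝ≥0∞, 0 < ε → ∃ M : ℕ, ∀ m m' : ℕ, M ≤ m → M ≤ m' →
      ∫⁻ X, kineticDensity (fun Y => (Φ m).ψ Y - (Φ m').ψ Y) X ≤ ε)
    {θ : ℝ} (hθ : 0 < θ) {τ : ℝ≥0∞} (hτ : 0 < τ) :
    ∃ G : Config N → ℂ, ContDiff ℝ 1 G ∧ (∀ X, X ∉ boxN N L → G X = 0) ∧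
      (∀ (σ : Equiv.Perm (Fin N)) (X : Config N), G (X ∘ σ) = G X) ∧
      ∫⁻ X, (‖G X - Ψ X‖₊ : ℝ≥0∞) ^ 2 ≤ 4 * τ ∧
      ∫⁻ X, kineticDensity G X + interaction v X * (‖G X‖₊ : ℝ≥0∞) ^ 2 ≤
        ENNReal.ofReal (1 + θ) * (S + τ) + τ := by
  have hτ2 : (0 : ℝ≥0∞) < τ / 2 := ENNReal.div_pos hτ.ne' ENNReal.ofNat_ne_top
  have hS1 : S + 1 ≠ ⊤ := ENNReal.add_ne_top.2 ⟨hS, ENNReal.one_ne_top⟩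
  have h1 : ∀ m : ℕ, ((m : ℝ≥0∞) + 1)⁻¹ ≤ 1 := fun m => ENNReal.inv_le_one.2 le_add_self
  set T : ℝ≥0∞ := ENNReal.ofReal (1 + θ⁻¹) with hT
  -- the kinetic tolerance `ε`
  set c₁ : ℝ≥0∞ := (T * ENNReal.ofReal (32 * A) + ENNReal.ofReal (288 * (b / 81) ^ 2)) *
    ((N : ℝ≥0∞) * N) * 4 with hc₁
  have hc₁t : c₁ ≠ ⊤ := by rw [hc₁]; finiteness
  set ε : ℝ≥0∞ := (τ / 2) / c₁ with hε_def
  have hε : 0 < ε := ENNReal.div_pos hτ2.ne' hc₁t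
  have hc₁ε : c₁ * ε ≤ τ / 2 := ENNReal.mul_div_le
  -- the Cauchy index `M` and the layer width `s`
  obtain ⟨M, hM⟩ := hCauchy ε hε
  have hkinM : ∫⁻ X, kineticDensity (Φ M).ψ X ≠ ⊤ :=
    ne_top_of_le_ne_top hS1 ((lintegral_mono fun X => le_self_add).trans
      ((hΦE M).trans (add_le_add le_rfl (h1 M))))
  obtain ⟨s₀, hs₀, hs₀ε⟩ := hLayer (Φ M).ψ (Φ M).contDiff hkinM ε hε
  set s : ℝ := min s₀ (b / 81) with hs_def
  have hs : 0 < s := lt_min hs₀ (by positivity)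
  have hsb' : s ≤ b / 81 := min_le_right _ _
  have hsb : 81 * s ≤ b := by linarith
  have hss₀ : s ≤ s₀ := min_le_left _ _
  -- the layer `U` and the core `K`
  set U : Set (Config N) := {Y | ∃ i j : Fin N, i ≠ j ∧ b - s < dist (Y i) (Y j) ∧
    dist (Y i) (Y j) < b + 3 * s} with hU
  have hUm : MeasurableSet U :=
    measurableSet_pair (fun r => b - s < r ∧ r < b + 3 * s) measurableSet_Ioo
  set K : Set (Config N) := {Y | ∃ i j : Fin N, i ≠ j ∧ dist (Y i) (Y j) ≤ b} with hK
  -- the layer kinetic energy of every later `Φ m` is `≤ 4ε`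
  have hlayM : ∫⁻ X, U.indicator (kineticDensity (Φ M).ψ) X ≤ ε := by
    refine (lintegral_mono fun X =>
      indicator_le_indicator_of_subset ?_ (fun _ => zero_le) X).trans hs₀ε
    rintro Y ⟨i, j, hij, h1, h2⟩
    exact ⟨i, j, hij, by linarith, by linarith⟩
  have hlay : ∀ m, M ≤ m → ∫⁻ X, U.indicator (kineticDensity (Φ m).ψ) X ≤ 4 * ε := by
    intro m hm
    have hdm : Differentiable ℝ (Φ m).ψ := (Φ m).contDiff.differentiable one_ne_zero
    have hdM : Differentiable ℝ (Φ M).ψ := (Φ M).contDiff.differentiable one_ne_zero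
    calc ∫⁻ X, U.indicator (kineticDensity (Φ m).ψ) X
        ≤ ∫⁻ X, 2 * U.indicator (kineticDensity (Φ M).ψ) X +
            2 * kineticDensity (fun Y => (Φ m).ψ Y - (Φ M).ψ Y) X := by
          refine lintegral_mono fun X => ?_
          by_cases hX : X ∈ U
          · rw [indicator_of_mem hX, indicator_of_mem hX]
            exact kinetic_le_two_add hdm hdM X
          · rw [indicator_of_notMem hX, indicator_of_notMem hX]
            exact zero_le
      _ = 2 * (∫⁻ X, U.indicator (kineticDensity (Φ M).ψ) X) +
            2 * ∫⁻ X, kineticDensity (fun Y => (Φ m).ψ Y - (Φ M).ψ Y) X := by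
          rw [lintegral_add_left
              (((measurable_kineticDensity (Φ M).contDiff).indicator hUm).const_mul _),
            lintegral_const_mul' _ _ ENNReal.ofNat_ne_top,
            lintegral_const_mul' _ _ ENNReal.ofNat_ne_top]
      _ ≤ 2 * ε + 2 * ε :=
          add_le_add (mul_le_mul' le_rfl hlayM) (mul_le_mul' le_rfl (hM m M hm le_rfl))
      _ = 4 * ε := by ring
  -- the inner cutoff `η` (radii `b - s < b`) of Stub 15a
  obtain ⟨η, hη1, hη01, -, hη0, hηone, hηA⟩ := hCut (b - s) b (by linarith) (by linarith)
  rw [sub_sub_cancel] at hηA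
  -- choosing `m`
  set c₂ : ℝ≥0∞ := T * (Real.toNNReal ((A : ℝ) / ((b + 3 * s) - b) ^ 2) : ℝ≥0∞) *
    ((N : ℝ≥0∞) * N) * (288 * A + 1) with hc₂
  set c₃ : ℝ≥0∞ := 1 + (N : ℝ≥0∞) * ((N : ℝ≥0∞) * (288 * A + 1)) with hc₃
  obtain ⟨m, hMm, hCm, hm₂, hm₃, hmτ⟩ := ((eventually_ge_atTop M).and <|
    (eventually_ge_atTop ⌈(C : ℝ)⌉₊).and <|
    ((tendsto_const_mul_div_nat (c := c₂) (by rw [hc₂]; finiteness) hS1).eventually_le_const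
      hτ2).and <|
    ((tendsto_const_mul_div_nat (c := c₃) (by rw [hc₃]; finiteness) hS1).eventually_le_const
      hτ2).and <|
    tendsto_inv_natCast_add_one.eventually_le_const hτ).exists
  have hCm' : (C : ℝ) ≤ m := Nat.ceil_le.1 hCm
  -- the core mass of `Φ m`
  set core : ℝ≥0∞ := ∫⁻ X, K.indicator (fun Y => (‖(Φ m).ψ Y‖₊ : ℝ≥0∞) ^ 2) X with hcore_def
  have hcoreS : core ≤ (S + 1) / m := by
    refine (ENNReal.le_div_iff_mul_le (Or.inr (one_pos.trans_le le_add_self).ne')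
      (Or.inl (ENNReal.natCast_ne_top m))).2 ?_
    rw [mul_comm]
    exact (core_le hcore (Φ m) m).trans ((hΦE m).trans (add_le_add le_rfl (h1 m)))
  -- the shell masses of `Φ m` (Stub 15b)
  have hshell : ∀ i j : Fin N, i ≠ j →
      ∫⁻ X, (shellPair b (3 * s) i j).indicator (fun Y => (‖(Φ m).ψ Y‖₊ : ℝ≥0∞) ^ 2) X ≤
        ENNReal.ofReal (288 * s ^ 2) * (4 * ε) + (288 * A + 1) * core := by
    intro i j hij
    refine (hShell s η (Φ m).ψ i j hij hs hsb hη1 hη01 hη0 hηone hηA (Φ m).contDiff).trans ?_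
    refine add_le_add (mul_le_mul' le_rfl ((lintegral_mono fun X => ?_).trans (hlay m hMm)))
      (mul_le_mul' le_rfl (lintegral_mono fun X => ?_))
    · refine indicator_le_indicator_of_subset (fun Y hY => ?_) (fun _ => zero_le) X
      exact ⟨i, j, hij, hY.1, by linarith [hY.2]⟩
    · refine indicator_le_indicator_of_subset (fun Y hY => ?_) (fun _ => zero_le) X
      obtain ⟨i', j', hij', hlt⟩ := hY
      exact ⟨i', j', hij', hlt.le⟩
  have hsum := sum_sum_le hshell
  -- the outer cutoff `χ` (radii `b < b + 3s`) of Stub 15a and the cut-state bounds of Stub 15f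
  obtain ⟨χ, hχ1, hχ01, hχσ, hχ0, hχone, hχA⟩ := hCut b (b + 3 * s) hb (by linarith)
  obtain ⟨hQ, -, hD⟩ := stub_cutStateBound N L v b s C
    (Real.toNNReal ((A : ℝ) / ((b + 3 * s) - b) ^ 2)) m θ (Φ m) χ hv hb hs hCm' hθ hcore hC
    hχ1 hχ01 hχ0 hχone hχA
  have h32 : (Real.toNNReal ((A : ℝ) / ((b + 3 * s) - b) ^ 2) : ℝ≥0∞) *
      ENNReal.ofReal (288 * s ^ 2) = ENNReal.ofReal (32 * A) := by
    change ENNReal.ofReal _ * _ = _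
    rw [← ENNReal.ofReal_mul (by positivity)]
    congr 1
    rw [show (b + 3 * s) - b = 3 * s by ring, div_mul_eq_mul_div, div_eq_iff (by positivity)]
    ring
  have h288 : ENNReal.ofReal (288 * s ^ 2) ≤ ENNReal.ofReal (288 * (b / 81) ^ 2) :=
    ENNReal.ofReal_le_ofReal (mul_le_mul_of_nonneg_left (pow_le_pow_left₀ hs.le hsb' 2)
      (by norm_num))
  -- the cut state `G = χ Φₘ`
  have hGc : ContDiff ℝ 1 fun X => (χ X : ℂ) * (Φ m).ψ X :=
    (Complex.ofRealCLM.contDiff.comp hχ1).mul (Φ m).contDiff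
  refine ⟨fun X => (χ X : ℂ) * (Φ m).ψ X, hGc,
    fun X hX => by simp only [(Φ m).eq_zero X hX, mul_zero],
    fun σ X => by simp only [hχσ σ X, (Φ m).symm σ X], ?_, ?_⟩
  · -- `∫|G - Ψ|² ≤ 2∫|G - Φₘ|² + 2∫|Φₘ - Ψ|² ≤ 4τ`
    have hGΦ : ∫⁻ X, (‖(χ X : ℂ) * (Φ m).ψ X - (Φ m).ψ X‖₊ : ℝ≥0∞) ^ 2 ≤ τ := by
      refine hD.trans ?_
      calc core + _ ≤ core + (N : ℝ≥0∞) * ((N : ℝ≥0∞) *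
            (ENNReal.ofReal (288 * s ^ 2) * (4 * ε) + (288 * A + 1) * core)) :=
            add_le_add le_rfl hsum
        _ = c₃ * core + ENNReal.ofReal (288 * s ^ 2) * ((N : ℝ≥0∞) * N) * 4 * ε := by
            rw [hc₃]; ring
        _ ≤ c₃ * ((S + 1) / m) + c₁ * ε := by
            refine add_le_add (mul_le_mul' le_rfl hcoreS) (mul_le_mul' ?_ le_rfl)
            rw [hc₁]
            exact mul_le_mul' (mul_le_mul' (le_add_left h288) le_rfl) le_rfl
        _ ≤ τ / 2 + τ / 2 := add_le_add hm₃ hc₁ε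
        _ = τ := ENNReal.add_halves τ
    calc ∫⁻ X, (‖(χ X : ℂ) * (Φ m).ψ X - Ψ X‖₊ : ℝ≥0∞) ^ 2
        ≤ ∫⁻ X, 2 * (‖(χ X : ℂ) * (Φ m).ψ X - (Φ m).ψ X‖₊ : ℝ≥0∞) ^ 2 +
            2 * (‖(Φ m).ψ X - Ψ X‖₊ : ℝ≥0∞) ^ 2 := by
          refine lintegral_mono fun X => ?_
          rw [← sub_add_sub_cancel _ ((Φ m).ψ X) _]
          exact coe_nnnorm_add_sq_le _ _
      _ = 2 * (∫⁻ X, (‖(χ X : ℂ) * (Φ m).ψ X - (Φ m).ψ X‖₊ : ℝ≥0∞) ^ 2) +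
            2 * ∫⁻ X, (‖(Φ m).ψ X - Ψ X‖₊ : ℝ≥0∞) ^ 2 := by
          have hmeas : Measurable fun X =>
              (2 : ℝ≥0∞) * (‖(χ X : ℂ) * (Φ m).ψ X - (Φ m).ψ X‖₊ : ℝ≥0∞) ^ 2 :=
            (measurable_normSq (hGc.continuous.sub (Φ m).contDiff.continuous)).const_mul _
          rw [lintegral_add_left hmeas, lintegral_const_mul' _ _ ENNReal.ofNat_ne_top,
            lintegral_const_mul' _ _ ENNReal.ofNat_ne_top]
      _ ≤ 2 * τ + 2 * τ :=
          add_le_add (mul_le_mul' le_rfl hGΦ) (mul_le_mul' le_rfl ((hΦd m).trans hmτ))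
      _ = 4 * τ := by ring
  · -- the form bound
    calc ∫⁻ X, kineticDensity (fun Y => (χ Y : ℂ) * (Φ m).ψ Y) X +
          interaction v X * (‖(χ X : ℂ) * (Φ m).ψ X‖₊ : ℝ≥0∞) ^ 2
        ≤ ENNReal.ofReal (1 + θ) * energy (fun r => min (v r) (m : ℝ≥0∞)) (Φ m) +
            T * (Real.toNNReal ((A : ℝ) / ((b + 3 * s) - b) ^ 2) : ℝ≥0∞) *
              ((N : ℝ≥0∞) * ((N : ℝ≥0∞) *
                (ENNReal.ofReal (288 * s ^ 2) * (4 * ε) + (288 * A + 1) * core))) :=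
          hQ.trans (add_le_add le_rfl (mul_le_mul' le_rfl hsum))
      _ = ENNReal.ofReal (1 + θ) * energy (fun r => min (v r) (m : ℝ≥0∞)) (Φ m) +
            (T * ((Real.toNNReal ((A : ℝ) / ((b + 3 * s) - b) ^ 2) : ℝ≥0∞) *
              ENNReal.ofReal (288 * s ^ 2)) * ((N : ℝ≥0∞) * N) * 4 * ε + c₂ * core) := by
          rw [hc₂]; ring
      _ ≤ ENNReal.ofReal (1 + θ) * (S + τ) + (c₁ * ε + c₂ * ((S + 1) / m)) := by
          rw [h32]
          refine add_le_add (mul_le_mul' le_rfl ((hΦE m).trans (add_le_add le_rfl hmτ)))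
            (add_le_add (mul_le_mul' ?_ le_rfl) (mul_le_mul' le_rfl hcoreS))
          rw [hc₁]
          exact mul_le_mul' (mul_le_mul' le_self_add le_rfl) le_rfl
      _ ≤ ENNReal.ofReal (1 + θ) * (S + τ) + (τ / 2 + τ / 2) :=
          add_le_add le_rfl (add_le_add hc₁ε hm₂)
      _ = _ := by rw [ENNReal.add_halves]

end ClosedEnergyTrunc

/-- **Registered landing stub of this support file** (`stub_closedEnergyTruncOneStep`, =
`ClosedEnergyTrunc.one_step` with all binders explicit): one cut state `G` (`C¹`, Dirichlet,
symmetric, `∫|G - Ψ|² ≤ 4τ`, `Q_v(G) ≤ (1+θ)(S+τ) + τ`) from the statements of Stubs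
15a/15b/15d, the diagonal trial states `Φₘ` and their kinetic Cauchy property.
[cite: LSSY2005, proof of Thm 2.4] -/
theorem stub_closedEnergyTruncOneStep :
    ∀ (N : ℕ) (L : ℝ) (A C : ℝ≥0) (b : ℝ) (v : ℝ → ℝ≥0∞) (Ψ : Config N → ℂ) (S : ℝ≥0∞)
      (Φ : ℕ → TrialState N L) (θ : ℝ) (τ : ℝ≥0∞),
      (∀ r₁ r₂ : ℝ, 0 < r₁ → r₁ < r₂ →
        ∃ χ : Config N → ℝ, ContDiff ℝ 1 χ ∧ (∀ X, 0 ≤ χ X ∧ χ X ≤ 1) ∧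
          (∀ (σ : Equiv.Perm (Fin N)) (X : Config N), χ (X ∘ σ) = χ X) ∧
          (∀ X : Config N, (∃ i j : Fin N, i ≠ j ∧ dist (X i) (X j) ≤ r₁) → χ X = 0) ∧
          (∀ X : Config N, (∀ i j : Fin N, i ≠ j → r₂ ≤ dist (X i) (X j)) → χ X = 1) ∧
          (∀ X : Config N, realKinetic χ X ≤
            {Y : Config N | ∃ i j : Fin N, i ≠ j ∧ r₁ < dist (Y i) (Y j) ∧
                dist (Y i) (Y j) < r₂}.indicator
              (fun _ => ENNReal.ofReal ((A : ℝ) / (r₂ - r₁) ^ 2)) X)) →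
      (∀ (s : ℝ) (η : Config N → ℝ) (ψ : Config N → ℂ) (i j : Fin N), i ≠ j →
        0 < s → 81 * s ≤ b → ContDiff ℝ 1 η → (∀ X, 0 ≤ η X ∧ η X ≤ 1) →
        (∀ X : Config N, (∃ i' j' : Fin N, i' ≠ j' ∧ dist (X i') (X j') ≤ b - s) → η X = 0) →
        (∀ X : Config N, (∀ i' j' : Fin N, i' ≠ j' → b ≤ dist (X i') (X j')) → η X = 1) →
        (∀ X : Config N, realKinetic η X ≤
          {Y : Config N | ∃ i' j' : Fin N, i' ≠ j' ∧ b - s < dist (Y i') (Y j') ∧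
              dist (Y i') (Y j') < b}.indicator (fun _ => ENNReal.ofReal ((A : ℝ) / s ^ 2)) X) →
        ContDiff ℝ 1 ψ →
        ∫⁻ X, (shellPair b (3 * s) i j).indicator (fun Y => (‖ψ Y‖₊ : ℝ≥0∞) ^ 2) X ≤
          ENNReal.ofReal (288 * s ^ 2) *
              (∫⁻ X, (shellPair (b - s) (4 * s) i j).indicator (kineticDensity ψ) X) +
            (288 * (A : ℝ≥0∞) + 1) *
              ∫⁻ X, {Y : Config N | ∃ i' j' : Fin N, i' ≠ j' ∧ dist (Y i') (Y j') < b}.indicator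
                (fun Y => (‖ψ Y‖₊ : ℝ≥0∞) ^ 2) X) →
      (∀ Φ : Config N → ℂ, ContDiff ℝ 1 Φ → ∫⁻ X, kineticDensity Φ X ≠ ⊤ →
        ∀ ε : ℝ≥0∞, 0 < ε → ∃ s : ℝ, 0 < s ∧
          ∫⁻ X, {Y : Config N | ∃ i j : Fin N, i ≠ j ∧ b - s < dist (Y i) (Y j) ∧
              dist (Y i) (Y j) < b + 3 * s}.indicator (kineticDensity Φ) X ≤ ε) →
      0 < b → Measurable v → (∀ t : ℝ, t ∈ Set.Icc 0 b → v t = ⊤) →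
      (∀ t : ℝ, b < t → v t ≤ C) → S ≠ ⊤ →
      (∀ m : ℕ, energy (fun r => min (v r) (m : ℝ≥0∞)) (Φ m) ≤ S + ((m : ℝ≥0∞) + 1)⁻¹) →
      (∀ m : ℕ, ∫⁻ X, (‖(Φ m).ψ X - Ψ X‖₊ : ℝ≥0∞) ^ 2 ≤ ((m : ℝ≥0∞) + 1)⁻¹) →
      (∀ ε : ℝ≥0∞, 0 < ε → ∃ M : ℕ, ∀ m m' : ℕ, M ≤ m → M ≤ m' →
        ∫⁻ X, kineticDensity (fun Y => (Φ m).ψ Y - (Φ m').ψ Y) X ≤ ε) →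
      0 < θ → 0 < τ →
      ∃ G : Config N → ℂ, ContDiff ℝ 1 G ∧ (∀ X, X ∉ boxN N L → G X = 0) ∧
        (∀ (σ : Equiv.Perm (Fin N)) (X : Config N), G (X ∘ σ) = G X) ∧
        ∫⁻ X, (‖G X - Ψ X‖₊ : ℝ≥0∞) ^ 2 ≤ 4 * τ ∧
        ∫⁻ X, kineticDensity G X + interaction v X * (‖G X‖₊ : ℝ≥0∞) ^ 2 ≤
          ENNReal.ofReal (1 + θ) * (S + τ) + τ :=
  fun _ _ _ _ _ _ _ _ _ _ _ hCut hShell hLayer hb hv hcore hC hS hΦE hΦd hCauchy hθ hτ =>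
    ClosedEnergyTrunc.one_step hCut hShell hLayer hb hv hcore hC hS hΦE hΦd hCauchy hθ hτ

end Summit.AtomisticToContinuum.BoseEinsteinCondensation.Theorems.GroundStateRigidity

end
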